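import Literature.MathematicalPhysics.QuantumFieldTheory.Balaban1983to89.B12Lemma4Uses
import Literature.MathematicalPhysics.QuantumFieldTheory.Balaban1983to89.B12Inv329

/-!
# `Balaban1983to89.B12Carve22Sect3Lemma4Hyp` — [Balaban1987RG1] Sect. 3, part 2, pp. 275 (3.26) – 281 (first paragraph)
# [PDF 27–33]: the gauge fixings (3.26)–(3.27), the transformed expression (3.28) and its invariance (3.29), the variables
# (3.30)–(3.32), the fundamental expansion (3.33)–(3.35), the analyticity statement (3.36) and its proof (3.37)–(3.52),
# Lemma 4 (3.53), the Cauchy bound (3.54) with its localization caveat and the constant remark, the closing paragraph p. 281 —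
# CARVED: the block's printed statements conjoined BY NAME into one hypothesis bundle `Hyp` over one package of letters, the two
# printed sentences of p. 276 that no declaration of the tree states AS A STATEMENT typed hypothesis-form, the in-tree citation
# index of the block's twelve SKELETON rows, and kernel-checked bookkeeping out of the bundle — nothing printed is proved here

statement-level skeleton of published theorems with citation tags; proofs where landed; nothing here is a claim about the
Yang–Mills mass gap

CITATION HEADER (lean-in-tree rule).  B12 = [I] = T. Bałaban, *Renormalization group approach to lattice gauge field theories. I.
Generation of effective actions in a small field approximation and a coupling constant renormalization in four dimensions*, Commun.
Math. Phys. **109** (1987) 249–301 [Balaban1987RG1] (doi:10.1007/bf01215223; held `paper:balaban1987-cmp109-rg-i-small-field`, journal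
page = PDF page + 248; text layer `pNNNN.txt` of `lit read`, cited below as `p00NN.txt:Lnn`; the page renders
`pub/pub-balaban/b2b-balaban-ref1/pages/1987-cmp109-rg-I-small-field/…-p027-x2.png … -p033-x2.png` of pp. 275–281 were READ AS IMAGES by
this seat, 2026-08-28 — every display quoted below was checked on them, the text layer being garbled in the formulas).  References of the
section: [12] = [Balaban1985Averaging] (CMP **98**), [14] = [Balaban1985RegularSpaces] (CMP **99**), [15] = [Balaban1985Variational] (CMP **102**),
[7] = the author's (Higgs)₂,₃ papers, [43] = the ultraviolet-stability papers.  Cell `lit-balaban`, P6 CARVING FAN (D-0154 (3b)), BLOCK 22 of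
`carve/BLOCKS-21-30.md` (lead g30, 2026-08-28T05:30Z; boundary note carve-plan 06:00:57Z: the displays (3.26) p.275:L27 and (3.27)
p.275:L38 [PDF 27] print before the signed page range and are read WITH this block; block 21 stops at (3.25)): source section = [B12]
Sect. 3 part 2, journal pp. 275–281 [PDF 27–33], displays (3.26)–(3.54), Lemma 4 p. 280; KEY item `stmt-QuantumFields-20543` (K2⁷
`EndpointGivenBR13SepCoPH`); also feeds `stmt-QuantumFields-20544`.  Seat `lit-balaban-carve-06` g6 (literature-prover-lit-balaban-carve-06-g6-0;
RULING #8 downward claim, carve/STATUS.md 2026-08-28T08:10:21Z; referee of record check-2 ∕ its successor).  Rules `carve/CARVE-RULES.md`: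
in tree = cite, never restate; hypothesis form; no `instance`, no `notation`; 0 sorry; desk stems untouched (the `Node00/…` carriers of
(3.26)–(3.53) are CITED below, never written into).

WHAT THIS FILE IS.  This half-section of [I] prints ONE numbered statement, Lemma 4 p. 280, and is otherwise the CONSTRUCTION (3.26)–(3.32)
of the variables of the fundamental expansion (3.33)–(3.34) and the PROOF (3.37)–(3.52) of the analyticity statement (3.36)/(3.53), closed
by the Cauchy estimate (3.54) of the fifth-order remainder «of the form (3.35)».  The block is the most densely formalized stretch of the
cell's tree: 683 declarations in 103 files carry a locator in pp. 275–281, Lemma 4 is a THEOREM on the concrete spaces of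
`B12RegularSpaces111` for every package of its by-reference inputs (`B12Lemma4ConcreteFrame.lemma4Printed_frameOf`, with the model instance
`B12Lemma4DataInstance.lemma4Data_nonvacuous`), and (3.32), (3.34), (3.35), (3.41)–(3.52), (3.54), the localization caveat, the constant
remark and the closing paragraph p. 281 are PROVED (index below).  Accordingly this file (i) RESTATES NOTHING that has a declaration: every
SKELETON row and every asserting sentence of the range is homed in the INDEX ∕ CENSUS below on its in-tree declaration, cited by name;
(ii) takes as THE LETTERS of the block one package `D : B12Lemma4ConcreteFrame.Lemma4Data` of the by-reference inputs of Lemma 4 over the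
concrete carriers (the tree's reading of record of (3.26)–(3.31), (3.37)–(3.50): frames of `X` and `□₀`, the set (3.31), `|B′|`, the maps
`𝐊 = 𝐇_j(□₀, τQ(L⁻¹η𝐇_{k+1}(□₀, (1/i) log V(𝐔))))`, `𝐀₂`, and for every value of the variables a `JInputs` package: the gauge transformations
`u_j, ū_{k+1}, v_j, v` with the costs (3.26)/(3.27)/(3.37), the identities (3.37)+(3.39), (3.38), (3.42), the sizes (3.37), (3.45), (3.50)),
the two p. 276 gauge transformations `v(𝐔)`, `u_{k+1}(𝐔)` and the (3.25)-versus-(3.28) letters `U325`, `g328`, and one abstract recipe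
`R329 : B12Inv329.Recipe` of the invariance statement (3.29) with the class `nbhd329` of admissible transformations; (iii) types,
hypothesis-form and in the exact binder shapes the tree's theorems consume, the TWO printed sentences of the range that no declaration
states as a statement — `Gauge276Printed` (p. 276 «these gauge transformations are explicitly given analytic functions of 𝐔, depending on
𝐔 restricted to the cube □₀» — in tree only the DERIVED letters' analyticity `Lemma4Data.hKan`/`hA2an` and a docstring quotation in
`B12Lemma4ConcreteFrame`/`B12CondIIIJConcreteModels`; the locality clause nowhere) and `Eq328Printed` (p. 276 «Performing these gauge
transformations in (3.25) we obtain (3.28)» — the configuration identity behind (3.28), in tree only the binder `h328` of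
`B12Lemma4Uses.analyticAt_E325_of_eq328U` ∕ `analyticAt_E325_of_eq328`); (iv) defines ONE bundle `Hyp` = the conjunction, by name, of
«all the restrictions» (`B12Sec2to5.Lemma4Restrictions`), the two residuals, and (3.29) on the printed class (`B12Inv329.Recipe.Inv329At`
for every `u` of a neighbourhood of the `G`-valued transformations); (v) kernel-checks (§3) what the bundle delivers through the tree's own
theorems: Lemma 4 (3.53) itself (`Letters.lemma4`, by `lemma4Printed_frameOf` — a THEOREM for every package, so NOT a bundle field), the
membership (3.53)/(3.36) unbundled (`Hyp.comp_mem`), the p. 275 claim «We will prove that it [(3.25)] is analytic on the space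
U^c_{k+1}(□₀, (1+2β)α₀, (1+2β)α₁, α₀)» from `eq328` + Lemma 4 + the p. 263 hypotheses (1.18)/(1.19) in their tree shapes
(`Hyp.analyticAt_E325`, by `B12Lemma4Uses.analyticAt_E325_of_eq328U`), (3.29) for block-constant `u` WITHOUT the bundle
(`Letters.inv329_blockConstant`, the recipe algebra `B12Inv329.Recipe.inv329At_of_isBlockConstant`) and for `G`-valued `u` from it
(`Hyp.inv329_gValued`), and the locality projection (`Hyp.gauge_local`).

## INDEX — the twelve SKELETON rows of § Block 22 and their in-tree homes (R3: cited, never restated)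

| row | print | in tree (cited BY NAME; status) |
|---|---|---|
| B12.Eq3.26-3.27 | (3.26) p.275:L27 «M˙(𝐔) = V^v, |V(b) − 1| < O(1)Mα₀, |v − 1| < O(1)Mα₁»; (3.27) p.275:L38 «U_{k+1}(□₀, V) = (exp iL⁻¹η𝐇_{k+1}(□₀, (1/i) log V))^{u_{k+1}}, |𝐇_{k+1}(…)|, |∇^{L⁻¹η}𝐇_{k+1}(…)|, ‖𝐇_{k+1}(…)‖_{1,β} < B₃O(1)Mα₀ on □̃⁴, for 0 ≤ β ≤ β₀ < 1, |u_{k+1} − 1| < B₃O(1)Mα₀ on □₀» | typed-existing: the abstract frame `B12Sec2to5.Lemma4Frame` (carriers `CfgU/CfgA/CfgB/CfgUJ`, `Uprime`, `A331`, `normB`, `Ucj`, `comp`, `analyticOn`; docstring (3.26)–(3.31)) and its concrete data `B12Lemma4ConcreteFrame.Lemma4Data` ∕ `JInputs` (letters `v`, `ubar1` = ū_{k+1}, costs `hv : ‖v y‖‖v y⁻¹‖ ≤ e^{O(1)Mα₁}`, `hubar1 ≤ e^{B₃O(1)Mα₀}` — the rotation-cost reading of `B12Ineq341Rotation` (`cost_composite_le`,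 `ineq341_first`)); the potentials' line of (3.27) = the norm form of [15]'s chart `B11Eq174Chart.Regime.norm_chartH_le`, `B12Eq45BlockBound.norm_chartH179_le`, and the datum of (3.37) built from it `B12Lemma4ChartSizes.norm_datum_le_of_chart`; desk carriers `Node00/CarriersB12Datum.lean`, `Node00/CarriersB12DatumRegion.lean` (reading R-F1 of (3.27)), `Node00/CarriersB12Chart.lean`, `Node00/CarriersB12.lean` — USED here as the letters `Letters.D`, `Letters.v`, `Letters.uk1` |
| B12.Eq3.28-3.29 | (3.28) p.276:L2–5; (3.29) p.276:L15–22 «The functions (3.25), (3.26) are gauge invariant with respect to the simultaneous gauge transformations 𝐔 → 𝐔^u, 𝐉 → R(u)𝐉, B → R(u)B, (3.29) for Gᶜ-valued transformations u in a sufficiently small neighborhood of G-valued transformations, so that the configurations after the transformations belong to proper spaces also. The expressions in (3.28) transform in a very simple way under (3.29), namely by R(u(y₀))» | typed-existing: `B12Inv329.Recipe` (fields `bc`, `𝒰`, `cov` = «transform … by R(u(y₀))», `Ψ`, `joint`), `B12Inv329.Recipe.Inv329At` — USED as the field `Hyp.inv329` on the class `Letters.nbhd329`; PROVED around it: `Recipe.inv329At_of_isBlockConstant`,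 `inv329At_iff_slotInvAt`, `inv329At_iff_isBlockConstant_of_detects`, `not_forall_inv329` (independence witness), `Regauging` (cell rows G-adv7-7 ∕ C-adv7-16), `B12Inv329Detect`; the near-`G` clause «so that the configurations after the transformations belong to proper spaces also» PROVED for the concrete (i)–(iii): `B12Spaces329Near.satisfiesI_III_act_near`, `B12Spaces329NearSharp.satisfiesI_III_act_near_sharp` ∕ `exists_neighbourhood`, `B12Spaces329NearStep.exists_neighbourhood_step`, with `B12Spaces329NearBond.gaugeU_factor_near`, `B12Spaces329BCH.norm_bchRem_incr2_le`; (3.28)'s identity = residual `Eq328Printed` below |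
| B12.Eq3.30-3.32 | (3.30) p.276:L26–29 «A = (1/iη) log(exp iη𝐀 exp iL⁻¹η𝐇_{k+1}(□₀, (1/i) log V)), B = Q(ηA) on □₀»; (3.31) p.276:L34–36 «|𝐀|, |∇^η𝐀|, ‖𝐀‖_{1,β} < α₂ on □₀, for 0 ≤ β ≤ β₀ < 1»; (3.32) p.277:L2–3 | (3.30) WITH BODY: `B12QPrime348.lam330` (`Λ = newPot`, `B12Membership313II.newPot`), `B12Ineq349Regular.eq348_regular`; (3.31) = the set `Lemma4Frame.A331` ∕ `Lemma4Data.A331` and, PROVED for the cut-off field «Obviously such bounds are satisfied by the function (tζ̃_□ + t_□ζ_□)𝐇_k(B′) for ε₁ sufficiently small» p.276:L36–37: `B12Ineq331Cutoff.ineq331_cube_of_small` (with `zeta_profile_constants`, `holderSeminorm_grad_cubeCutoffC_le`); (3.32) PROVED: `B12Ineq332.ineq332_sup`, `ineq332_grad`, `ineq332_holder` |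
| B12.Eq3.33-3.34 | (3.33)–(3.34) p.277:L5–8, «the fundamental expansion for the analysis of renormalization» | PROVED: `B12Taylor334.taylor334` (`taylor5_integral_remainder`, `iteratedDeriv_comp_ray`) |
| B12.Eq3.35 | (3.35) p.277:L13–16 «By the definition of B and by the inequalities (3.32) we have |B| < O(1)L^jη, hence we expect that this term can be bounded by O(1)exp(−κd_j(X))(O(1)L^jη)⁵» | PROVED: `B12CauchyRemainder354.ineq335_of_354`, `remainder334_norm_le_printed`; «|B| < O(1)L^jη» on the carriers of record: `Node00/CarriersB12DatumRegion.lean` (`norm_Q_near_le`, `norm_datNear_le`), and as the displayed size `|a| ≤ α₁x` of `B12Remainder354Localized.remainder334_localized_335` |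
| B12.Eq3.36 | (3.36) p.277:L21–24 «(U_j(□₀, exp iτB), J_j(□₀, exp iτB))|_X ∈ U^c_j(X, α₀, α₁) for all 𝐔, 𝐉, 𝐀 in the above spaces, and for the parameters τ in the interval [0,1]» | typed + PROVED: `B12Sec2to5.Lemma4Printed` (first conjunct at `B′ = 0`), `B12Lemma4Space.satisfiesI_III_eq336`, `B12Lemma4Assembled.ofBackground_mem_space'_eq336_of_upper_space` |
| B12.Eq3.37-3.47 | (3.37) p.277:L29–32; p.277:L33 «Assume now that B₃²O(1)Mα₀ < ½α₁, then the orbit … contains the configuration exp iξ𝐇_j(…) satisfying the conditions (i), (ii)»; (3.38) p.278:L2–10 with «ū_j … constant on blocks … equal to u_j at centers of the blocks» and «the condition (iv) is a consequence of the condition (iii), with a bit better constant»; (3.39) «Using (97) [12], (3.27), (3.26) we obtain for τ = 1»; (3.40); (3.41) «for α₁ sufficiently small, e.g. O(1)Mα₁ ≤ β»; (3.42); (3.43) «We assume that (4B₃²O(1)M)²α₀ ≤ β»; (3.44); (3.45) «the functions on the right-hand side [of (174) [15]] are at least of second order, except the first term»; (3.46); p.279:L11–14 «linear in Q(…) … reverse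 the arguments … (3.44) with τQ(…), and the factor 1 + 6β»; (3.47); p.279:L16 «j ≤ k, hence L^jη ≤ 1 and (1 + 7β)L⁻² ≤ 1 for β not too large»; p.279:L17–21 the second inequality of (iii) «in the same way» | (3.37) sizes: `B12Plaquette343.sum337`, `B12Lemma4ChartSizes.ineq337_letter` ∕ `ineq337_grad` ∕ `…_on` (DERIVED for [15]'s chart), letters `JInputs.hH/hHd/hK/hKd/uj/huj`; (i),(ii): `B12Lemma4Concrete.expI_mem_space`, `condII_one`, `satisfies_expI`; (3.38): letters `JInputs.h338/hJn/h338₁/hJn₁/hubar` and PROVED consequence `B12Eq338CondIV.condIV_of_eq338`, `condIV_one_of_eq338`, `satisfies_expI_of_eq338` (the (iv)-margin of the count `1 + 8β`: `margin352`, `margin352_of_restrictions`, `margin_not_from_restrictions`); (3.39): letter `JInputs.h339`; (3.40) PROVED: `B12Lemma4Chain.ineq340_of_satisfies`, `ineq340_first_on`; (3.41) PROVED: `B12Ineq341Rotation.ineq341_first`, `h41_of_eq339`, `ineq341_printed_of_eq339`, `B12ExpSteps.ineq341`, `ineq341_printed`, `step341` (and the restriction audit `lemma4Restrictions_not_sufficient_341`,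 `repaired_restrictions_satisfiable`); (3.42) PROVED: `B12Ineq341Rotation.ineq342`, `h42_of_eq342`; (3.43) PROVED: `B12ExpSteps.ineq343`, `B12Plaquette343.elem343`, `ineq343_plaquette`; (3.44): `B12ExpSteps.ineq344_of_inputs`, `B12CondIIIJ.ineq344`, `B12Plaquette343.ineq344_plaquette`; (3.45): `B12CondIIIJ.ineq345_inner`, `B12Lemma4ChartSizes.norm_curl_chartH_sub_lin_le`, `ineq345_tau`, `ineq345_one` («at least of second order»: (177) [15]); (3.46): `B12CondIIIJ.ineq346`, `B12Plaquette343.tri346`; τ-reversal with `1 + 6β`: `B12CondIIIJ.ineq344τ`; (3.47): `B12CondIIIJ.ineq347`, `ineq347_closes`, `ladder_closes`, `B12Plaquette343.tri347`; the scaling remark: `B12Sec2to5.scale_sq_le`, `B12CondIIIJ.scale_le`; first half of (iii): `B12ExpSteps.condIII_first_of_inputs`, `B12Plaquette343.condIII_first_plaquette`, `B12Lemma4Concrete.condIII_first_plaq` ∕ `condIII_first_region`; second half of (iii) «in the same way»: `B12CondIIIJ.condIII_second_of_inputs`, `jLadder_bound`, `condIII_both_of_restrictions`, `B12CondIIIJConcrete`,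 `B12CondIIIJConcreteModels`; the restrictions: `B12Sec2to5.Lemma4Restrictions` — USED as `Hyp.restrictions` |
| B12.Eq3.48-3.49 | (3.48) p.279:L22–24; (3.49) p.279:L25–27 «|Q′| ≤ O(1)L^jη|𝐀| < O(1)α₂L^jη on □₀, with an absolute constant O(1). It is an analytic and almost local function of 𝐀 and 𝐇_{k+1}» | PROVED: `B12QPrime348.eq348`, `eq348_printed`, `qPrime`, `norm_qPrime_le`, `ineq349_printed`, `eq348_lam330`, `ineq349_lam330` (analyticity in 𝐀: `analyticAt_newPot_left`, `contDiffOn_lam330`); hypothesis-free at backgrounds: `B12Ineq349Flat.ineq349_flat` ∕ `eq348_flat`, `B12Ineq349Regular.ineq349_regular` ∕ `eq348_regular`, `B12Ineq349PerBond.ineq349_lam330_perBond` ∕ `ineq349_lam330_local` («almost local»: the per-bond ∕ local operator form; the localisation itself is recorded as not modelled in `B12QPrime348` reading note (b)) |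
| B12.Eq3.50-3.52 | (3.50) p.279:L31–p.280:L3 «where the last equality is a definition of 𝐀₂. It implies |𝐀₂|, |∇^ξ𝐀₂| ≤ B₃|B′| < B₃α₃, and if B₃α₃ < ½α₁ then this and the inequality in (3.37) imply the conditions (i), (ii)»; (3.51) «where we have assumed 2B₃α₃ ≤ βL⁻²α₀»; (3.52) «This implies the first inequality in the condition (iii). The second is proved in the same way … The condition (iv) follows from the corresponding identity (3.38)» | (3.50): `B12Lemma4ChartSizes.eq350`, `norm_A2_le`, `norm_grad_A2_le`, `ineq350_letter`, `ineq350_grad`, letters `JInputs.hA/hAd`; (i),(ii): `B12Lemma4Concrete.norm_add_lt_alpha1`, `norm_grad_add_lt_alpha1`, `condII_one`; (3.51)–(3.52) PROVED: `B12Plaquette343.condIII_first_plaquette_shifted`, `budget352`, `budget352_of_restrictions`, `B12Lemma4CondIV.ineq352_plaquette` ∕ `ineq352_plaq` ∕ `ineq352_region` ((3.52) AS PRINTED), `B12CondIIIJ.jineq351`, `jineq352`; (iv) from (3.38): `B12Lemma4CondIV.condIV_lemma4_of_eq338`, `ofBackground_mem_space'_lemma4_of_eq338` |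
| B12.Lem4 | Lemma 4 p.280:L14–19, (3.53) «For 𝐔 ∈ U′ᶜ_{k+1}(□₀, (1+2β)α₀, (1+2β)α₁), 𝐀 defined on □₀ and satisfying (3.31), B′ … satisfying |B′| < α₃, we have (U_j(□₀, exp i(τB + B′)), J_j(□₀, exp i(τB + B′)))|_X ∈ U^c_j(X, α₀, α₁) (3.53) for α₀, α₁, α₂, α₃ sufficiently small and satisfying all the restrictions. The functions in (3.53) are analytic on the above spaces.» | typed: `B12Sec2to5.Lemma4Printed`, `Lemma4PrintedSmall`, `Lemma4Consts`, `Lemma4Restrictions`; PROVED on the concrete frame for every package: `B12Lemma4ConcreteFrame.lemma4Printed_frameOf`, `comp_mem_Ucj`, `frameOf`, `Lemma4Data`, `JInputs`, `LettersAnalyticAt`; the assembly `B12Lemma4Assembled.ofBackground_mem_space'_lemma4_of_upper_space`, `restrictions_nonvacuous`, `B12Lemma4Chain.mem_space'_lemma4_of_upper_space`, `B12Lemma4Space.mem_space'_lemma4` ∕ `ofBackground_mem_space'_lemma4`, `B12Lemma4CondIVModels`, `B12Lemma4Models`; analyticity clause: `B12CondIIIJConcreteModels.analyticAt_pair_lemma4`;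 «sufficiently small»: `B12Lemma4Uses.lemma4PrintedSmall_frameOf`; NON-VACUITY: `B12Lemma4DataInstance.trivData`, `lemma4Printed_trivData`, `domain_nonempty`, `comp_mem_Ucj_witness`, `lemma4Data_nonvacuous`; desk statement-level carriers `Node00.Lemma4Datum`, `Node00.Lemma4Datum.ofData` (`Node00/CarriersB12Family.lean`), `DagBinding.PrintedCarriersR.withB12` (`Node00/Record11CarriersB12.lean`), `Node00/CarriersB12Package.lean`, `Node00/Record12CarriersB12Package.lean`, `Node00/Record12CarriersB12Fundamental.lean` — DELIVERED here as `Letters.lemma4`, `Hyp.comp_mem` |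
| B12.Eq3.54 | (3.54) p.280:L20–29 and «Because |B| < O(1)L^jη, e.g. |σ| < …, hence we have the required bound» | PROVED: `B12CauchyRemainder354.ineq354`, `ineq354_printed`, `norm_iteratedDeriv_le_of_ball`, `remainder334_norm_le`; on the concrete frame with its two hypotheses discharged from Lemma 4: `B12Lemma4Uses.ineq354_frameOf`, `ineq354_frameOf_printed`, `differentiableOn_E_slice`, `norm_E_slice_le`; the caveat p.280:L29–34 «this bound holds on □̃⁴ only. We should localize the inner product in domains □̃⁴, (□̃⁴)ᶜ … an arbitrary power of L^jη» PROVED: `B12Remainder354Localized.iteratedFDeriv_split_norm_le`, `remainder334_localized_printed`, `remainder334_localized_335`, `norm_iteratedFDeriv_dir_le_frameOf`; the final remark p.280:L34–40 «much bigger than E₀ … differentiation with respect to t_□ … yields a factor O(1)α₂⁻¹ε₁» PROVED: `B12Remainder354Localized.deriv_tbox_le_factor`, `deriv_tbox_le_of_eps_small` |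
| B12.Txt@281 | p.281:L2–7 [PDF 33] «The considerations of this section gave a full control over the terms of the expansion of the difference 𝐄_k(U_k(exp iB′V^{(k)})) − 𝐄_k(U_k(V^{(k)})), except the terms in the sum on the right-hand side of (3.34). … The remaining terms are irrelevant according to our terminology, i.e. they satisfy bounds of the form (0.28) on their domains of analyticity.» | NOT absent (the § Block 22 spec's one unresolved row): PROVED as `B12Sect3Closing281.sect3_remaining_irrelevant`, `sect3_remaining_irrelevant_pos` (with `taylorRemainder_irrelevant_printed`, `farTerm_irrelevant_printed`, `localization_irrelevant`, `largeDomain_irrelevant`, `fifthOrder_bound_p258`) — cited, no residual |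

## CENSUS of the asserting sentences of the range without display number (R4; disposition in brackets)

p. 275 [PDF 27]: L19–21 «This is obviously a well defined and analytic function of the variables 𝐔, 𝐉 in a sufficiently small domain. We will
prove that it is analytic on the space U^c_{k+1}(□₀, (1+2β)α₀, (1+2β)α₁, α₀)» [the sentence straddles the block boundary; PROVED modulo
(3.28) and (1.19): `B12Lemma4Uses.analyticAt_E325_of_eq328` ∕ `analyticAt_E325_of_eq328U`, `E_act_comp_eq`, `analyticAt_E_comp` —
DELIVERED from the bundle as `Hyp.analyticAt_E325`]; L21–22 «This space is defined by the same conditions (i)–(iv), only the configurations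
𝐔, 𝐉 are defined and satisfy (i)–(iii) on the whole lattice T_η» [definition: the frame `F′` of `□₀` — `B12Lemma4ConcreteFrame.frameOf`
sets `Uprime a₀ a₁ := B12RegularSpaces111.space 𝓜 D.F' D.cs' a₀ a₁ D.γ₀'`; the whole-lattice reading in `B12Spaces329Near` (module head)];
L23–26 «We repeat the constructions of Sect. F [15], and we introduce the same generalized axial gauge for the configuration M˙(𝐔). This is
achieved by a gauge transformation v» [construction by reference: the letter `JInputs.v`, here `Letters.v`; [15] Sect. F in tree:
`B11AxialTransport190`, `B11GaugeGlue`]; L28–30 «The variables V can be expressed simply in terms of the contour variables introduced in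
(77) [12], e.g. in the simplest situation for a bond b ∈ □̃⁴ ∩ T^{(k+1)} we have V(b) = Ū^{k+1}(Γ_{y₀,b₋} ∪ b ∪ Γ_{b₊,y₀})» [an example
formula, definition-level; the contour variables (77) [12] in tree: `B12ContourAverage253`, `B7Eq106Concrete`]; L30–31 «We assume that α₀, α₁
are chosen so that Mα₀, Mα₁ are still small» [standing smallness, unquantified — carried by the explicit inequalities of
`B12Sec2to5.Lemma4Restrictions` (`O(1)Mα₁ ≤ β`, `B₃²O(1)Mα₀ < ½α₁`, `(4B₃²O(1)M)²α₀ ≤ β`), `Hyp.restrictions`; RULING #9: no parameter of a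
typed statement below enters otherwise than through these displayed thresholds]; L31–32 «We make the next gauge transformation u_{k+1}
changing the axial gauge into Landau gauge for the configuration U_{k+1}(□₀, V)» [construction by reference ([15] Prop. 9): letters
`JInputs.ubar1`, here `Letters.uk1`; the chart of [15] in tree `B11Eq174Chart.chartH`, `B11Eq183Differentiation.chartH179`, `B12Eq45BlockBound.norm_chartH179_le`].
p. 276 [PDF 28]: L6–9 «it is necessary to apply the gauge transformations to the variables 𝐉, B also … in the function 𝐇_k(B′) the
variables 𝐉, B are replaced by R(u_{k+1}⁻¹)R(v⁻¹)𝐉, R(u_{k+1}⁻¹)R(v⁻¹)B» [the recipe: the slots of `B12Inv329.Recipe.Ψ` rotate jointly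
(`joint`), `Recipe.F`, `F_smul`]; L10–12 «They [the bounds (3.26), (3.27)] imply that the above expressions have almost the same bounds as
𝐉, B» [remark-level, unquantified («almost the same»); its quantitative use is the rotation-cost algebra `B12Ineq341Rotation.norm_conj_le_cost`,
`norm_conj_sub_one_le_cost`, `cost_composite_le` — not typed]; L12–14 «Second, these gauge transformations are explicitly given analytic
functions of 𝐔, depending on 𝐔 restricted to the cube □₀. This will be important later on in a final localization» [RESIDUAL
`Gauge276Printed`: the analyticity of `v(𝐔)`, `u_{k+1}(𝐔)` along analytic families of `𝐔` in the upper space and their dependence on `𝐔|□₀`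
only; in tree only the analyticity of the DERIVED letters `𝐊`, `𝐀₂` (`Lemma4Data.hKan`, `hA2an`) and the quotation]; L20–22 «The expressions in
(3.28) transform in a very simple way under (3.29), namely by R(u(y₀)) … connected with the fact that the contour variables V transform this
way» [typed-existing: `B12Inv329.Recipe.cov` (`𝒰(𝐔^u) = 𝒰(𝐔)^{ũ}`, `bc` = restriction to the block centres `y₀`), `Recipe.joint`;
contour-variable covariance in tree `B12Average012Covariance`]; L30–32 «The function B above is defined on the set of bonds determining
U_j(□₀), i.e. on Λ_j ∩ ∪_{y∈□₀}□̃_y» [definition of a domain; carriers `Node00/CarriersB12Datum.lean`]; L36–38 «Obviously such bounds are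
satisfied by … for ε₁ sufficiently small. We have similar bounds for the function L⁻¹𝐇_{k+1}(□₀, (1/i) log V), with α₂ replaced by B₃O(1)Mα₀,
and □₀ by □̃⁴, see (3.27)» [PROVED `B12Ineq331Cutoff.ineq331_cube_of_small`; the second sentence restates (3.27)].
p. 277 [PDF 29]: L4 «These regularity conditions are basic for the further analysis», L9–12 (history, [72, 54, 68, 27, 7, 16, 41–44]), L17–20
(programme) [not statements]; L24–28 «We will prove a stronger statement … The analyticity of the functions in (3.34) follows from the
analyticity of the two functions in (3.36), and the assumed analyticity of 𝐄^{(j)}(X, 𝐔, 𝐉) on the space U^c_j(X, α₀, α₁)» [PROVED: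
`B12Lemma4Uses.analyticAt_E_comp`]; L33–p.278:L2 «We will prove that this configuration satisfies all the conditions (i)–(iv)» [PROVED:
`B12Lemma4Concrete.satisfies_expI`, `B12Eq338CondIV.satisfies_expI_of_eq338`].
p. 278 [PDF 30]: L28–p.279:L2 «This second restriction is not essentially stronger than the first one, because we have already assumed the
restriction O(1)Mα₁ ≤ β on α₁» [commentary on `Lemma4Restrictions`; the audit of what the restrictions do and do not give is
`B12ExpSteps.lemma4Restrictions_not_sufficient_341`, `B12Eq338CondIV.margin_not_from_restrictions` — cited, not adjudicated].
p. 279 [PDF 31]: L8–9 «Of course we have used also the exponential decay properties of all the functions which appeared above» [method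
remark; the decay inputs are the hypotheses `hS`, `hSτ`, `hA2` of `JInputs` and `B12Lemma4ChartSizes.jet_letter_dominated_on`]; L28 «We can
prove that for α₂ sufficiently small we still have (3.36). Instead we will prove a more general result. We replace τQ′ by the variable B′
with values in 𝔤ᶜ, and we prove (3.36) for B′ satisfying |B′| < α₃» [= Lemma 4; `Lemma4Printed`].
p. 280 [PDF 32]: L12–13 «Thus we have proved (3.36) in several versions. Let us formulate the one which will be used to bound the terms in
(3.34)» [meta; the versions: `B12Lemma4Space.satisfiesI_III_lemma4`, `satisfiesI_III_eq336`, `satisfiesI_III_lemma4_of_jBudget`]; L33–34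
«The considerations are similar to those done on several occasions, e.g. (3.6), (3.21), and we do not repeat them» [the device
`B12.exp_neg_inv_le_pow`, `B12NearTerms321.smallFactor321`, used by `B12Remainder354Localized.remainder334_localized_printed`].
p. 281 [PDF 33]: L2–7 [row B12.Txt@281 above, PROVED].
RESIDUAL (R4) = { `Gauge276Printed`, `Eq328Printed` }; every other asserting sentence of the range has a declaration (INDEX ∕ CENSUS).

## HONEST SCOPE

(a) The letters are the tree's: `Letters.D` is a `B12Lemma4ConcreteFrame.Lemma4Data` package — the EXISTENCE of the by-reference inputs of
[12, 14, 15] for every value of the variables is the substantive hypothesis of Lemma 4 in the tree's reading, and it is carried as DATA, exactly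
as in `lemma4Printed_frameOf` (whence Lemma 4 is delivered, not assumed: `Letters.lemma4`).  (b) `Gauge276Printed` and `Eq328Printed` are
typed over the concrete carriers (`B12RegularSpaces111.FieldPair/Region/gaugeU/expI/space`) in the binder shapes of `Lemma4Data.hKan` and of
`B12Lemma4Uses.analyticAt_E325_of_eq328U` (`h328`, `hg`): `U325 𝐔 𝐀` is the gauge-field argument of (3.25) as a function of `𝐔` and of the
`𝔤ᶜ`-valued variable `𝐀` of (3.30) (print p. 276: «replacing (tζ̃_□ + t_□ζ_□)𝐇_k(B′) by a 𝔤ᶜ-valued variable 𝐀», after the rotation of its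
variables `𝐉, B`), `g328 𝐔 𝐀` the composite `Gᶜ`-valued gauge transformation of (3.26)/(3.27) (and of (3.37), through which the tree's
Lemma-4 configuration `V = exp iξ(𝐊 + 𝐀₂)` is the Landau-gauge representative of `U_j(□₀, exp iB)`), BY REFERENCE — letters, not
constructions; the identity is stated at `τ = 1`, `B′ = 0` (the configuration of (3.28)/(3.33) is the Lemma-4 configuration at full `B` and no
`B′`), and `Hyp.normB_zero` records `|0| = 0` for the frame's abstract size letter `normB` (print's `|B′|` is a supremum norm).  (c) The recipe
`Letters.R329` of (3.29) lives on its own abstract carriers (`B12Inv329` §1: a group `𝒢` acting on backgrounds, `𝐉`- and `B`-variables; no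
complex structure, typing note (3) there), not identified here with the frame's carriers (the tree declares no `MulAction` of the gauge group on
`FieldPair`, and this file declares no instance); «a sufficiently small neighborhood of G-valued transformations» is the class letter
`nbhd329 ⊇ gValued` (`Hyp.gValued_sub`), membership in which is the only way the smallness enters (RULING #9 (2): displayed as the class
binder of `Hyp.inv329`, nothing unthresholded).  The cell's located reading of this paragraph (the printed covariance argument covers the
block-constant `u`: `Recipe.inv329At_of_isBlockConstant`, here `Letters.inv329_blockConstant`; the full class is the unprinted lift
`B12Inv329.Regauging` ∕ `StepInhabited` Part J) is CITED, not adjudicated: `Hyp.inv329` is print's sentence as a hypothesis.  (d) Nothing of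
Sect. 1 ((1.18), (1.19) p. 263) is bundled: where §3 needs them they are explicit hypotheses in the shapes of `B12Lemma4Uses` (`hE`, `hinv`).
(e) Satisfiability: `Letters` is inhabited over the instance `B12Lemma4DataInstance.trivData` with constant gauge letters `v = uk1 = 1`,
`g328 = 1`, `U325 𝐔 𝐀 := V(𝐔, 𝐀, 1, 0)` and the two-site witness recipe `B12Inv329.Witness.recipe` with `nbhd329 = gValued =` the block-constant
subgroup, at which every field of `Hyp` holds (constants are analytic and local; `gaugeU 1 = id`; `inv329At_of_isBlockConstant`) — recorded
here as a remark, not shipped as a declaration (CARVE-RULES do not require an in-file inhabitant; the Lemma-4 package itself is certified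
non-vacuous by `B12Lemma4DataInstance.lemma4Data_nonvacuous`).  (f) No summit statement is proved by this file; count-neutral for the
fleet's fact census (no `def … : Prop` without users: the two residuals are fields of `Hyp`).
-/

noncomputable section

open NormedSpace Complex Set Filter
open scoped Topology

namespace Literature.MathematicalPhysics.QuantumFieldTheory.Balaban1983to89.B12Carve22Sect3Lemma4Hyp

open Literature.MathematicalPhysics.QuantumFieldTheory.Balaban1983to89
open Literature.MathematicalPhysics.QuantumFieldTheory.Balaban1983to89.B12RegularSpaces111
open Literature.MathematicalPhysics.QuantumFieldTheory.Balaban1983to89.B12Eq18Current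
open Literature.MathematicalPhysics.QuantumFieldTheory.Balaban1983to89.B12Lemma4ConcreteFrame

/-! ## §1  The block's residual printed statements (no declaration in the tree), hypothesis form, page order -/

section Residuals

variable {P : Params} {i : ℕ} {𝔸 : Type} [NormedRing 𝔸] [NormedAlgebra ℂ 𝔸] [CompleteSpace 𝔸]

/-- **p. 276 [PDF 28] L12–14, verbatim: *«Second, these gauge transformations are explicitly given analytic functions of 𝐔, depending on
𝐔 restricted to the cube □₀. This will be important later on in a final localization.»*** — «these gauge transformations» = the axial-gauge
transformation `v` of (3.26) and the Landau-gauge transformation `u_{k+1}` of (3.27), as functions `v 𝐔`, `uk1 𝐔` of the configuration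
`𝐔 = (𝐔, 𝐉) ∈ dom` (print: the space U^c_{k+1}(□₀, (1+2β)α₀, (1+2β)α₁, α₀) of p. 275, «Let us assume this»).  Hypothesis form, two
conjuncts: (1) ANALYTIC — along every family `e ↦ 𝐔(e)` whose bond values are analytic at `e₀` with `𝐔(e₀) ∈ dom`, every site value of
`v(𝐔(e))` and of `u_{k+1}(𝐔(e))` is analytic at `e₀` (the shape of `B12Lemma4ConcreteFrame.Lemma4Data.hKan`, which carries this analyticity
only for the DERIVED letters `𝐊`, `𝐀₂`); (2) LOCAL — two configurations of `dom` whose gauge fields agree on the bonds of `□₀` have the same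
`v` and the same `u_{k+1}` (the shape of the tree's locality predicate `Node00.IsLocalizedIn`, p. 257 «depending on U restricted to X»).
[cite: Balaban1987RG1, p.276 L12-14; (3.26)-(3.27) p.275] -/
def Gauge276Printed (dom : Set (FieldPair P i 𝔸ˣ 𝔸)) (box0 : Region P i)
    (v uk1 : FieldPair P i 𝔸ˣ 𝔸 → Site P i → 𝔸ˣ) : Prop :=
  (∀ (E : Type) [NormedAddCommGroup E] [NormedSpace ℂ E] (Φf : E → FieldPair P i 𝔸ˣ 𝔸) (e₀ : E),
      (∀ b, AnalyticAt ℂ (fun e => ((Φf e).U b : 𝔸)) e₀) → Φf e₀ ∈ dom →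
        ∀ x, AnalyticAt ℂ (fun e => (v (Φf e) x : 𝔸)) e₀ ∧ AnalyticAt ℂ (fun e => (uk1 (Φf e) x : 𝔸)) e₀) ∧
    ∀ Φ ∈ dom, ∀ Φ' ∈ dom, (∀ b ∈ box0.bonds, Φ.U b = Φ'.U b) → v Φ = v Φ' ∧ uk1 Φ = uk1 Φ'

/-- **p. 276 [PDF 28] L2, verbatim: *«Performing these gauge transformations in (3.25) we obtain*
*𝐄^{(j)}(X, U_j(□₀, M˙(exp iηQ_j((1/iη) log [exp iη(tζ̃_□ + t_□ζ_□)𝐇_k(…) · exp iL⁻¹η𝐇_{k+1}(□₀, (1/i) log V)])))).  (3.28)»***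
(the variables `𝐉, B` inside `𝐇_k` rotated by `R(u_{k+1}⁻¹)R(v⁻¹)`, p. 276 L6–9) — the configuration-level identity behind the display, in the
tree's reading of record (the binders `h328`, `hg` of `B12Lemma4Uses.analyticAt_E325_of_eq328U`: «the (3.25) configuration is the gauge
transform `V^{g}` of the Lemma-4 configuration», (3.26)–(3.28) with (3.30)/(3.48) and the gauge transformation of (3.37)), hypothesis form over
one package `D` of the by-reference inputs of Lemma 4: for every `𝐔` of the upper space U′ᶜ_{k+1}(□₀, (1+2β)α₀, (1+2β)α₁) and every `𝐀` of the
class (3.31) — `U325 𝐔 𝐀` being the gauge-field argument `U_j(□₀, M˙(exp iη(·)U_{k+1}(□₀, M˙(𝐔))))` of (3.25) with the slot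
«(tζ̃_□ + t_□ζ_□)𝐇_k(B′)» read as the `𝔤ᶜ`-valued variable `𝐀` of (3.30) (p. 276 L25), and `g328 𝐔 𝐀` the composite, explicitly given gauge
transformation — `g328 𝐔 𝐀` is `Gᶜ`-valued and `U325 𝐔 𝐀 = V^{g328 𝐔 𝐀}`, `V = exp iξ(𝐊(𝐔, 𝐀, 1) + 𝐀₂(𝐔, 𝐀, 1, 0))` the Lemma-4 configuration
of `B12Lemma4ConcreteFrame.frameOf` at `τ = 1`, `B′ = 0` (the configuration `U_j(□₀, exp iB)` of (3.28)/(3.33) in the Landau gauge of (3.37)).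
Letters, not constructions: nothing of [12, 15] is built here. [cite: Balaban1987RG1, (3.28) p.276 L2-5; (3.25) p.275; (3.30) p.276; (3.37) p.277] -/
def Eq328Printed (𝓜 : Model 𝔸) (c : B12Sec2to5.Lemma4Consts) (D : Lemma4Data P i 𝓜 c)
    (U325 : FieldPair P i 𝔸ˣ 𝔸 → (PBond P i → 𝔸) → PBond P i → 𝔸ˣ)
    (g328 : FieldPair P i 𝔸ˣ 𝔸 → (PBond P i → 𝔸) → Site P i → 𝔸ˣ) : Prop :=
  ∀ Φ ∈ space 𝓜 D.F' D.cs' ((1 + 2 * c.β) * c.α₀) ((1 + 2 * c.β) * c.α₁) D.γ₀', ∀ A ∈ D.A331,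
    (∀ x, g328 Φ A x ∈ 𝓜.Gc) ∧
      U325 Φ A = gaugeU (g328 Φ A) (fun b => expI D.cs.ξ (D.K Φ A 1 b + D.A₂ Φ A 1 0 b))

end Residuals

/-! ## §2  The letters of the block and the bundle -/

/-- **THE LETTERS OF [I] SECT. 3, PART 2** (pp. 275–281), one renormalization step `k → k+1`, one term `(j, X)`, one big cube `□₀`:
* `D` — the package of the by-reference inputs of Lemma 4 over the concrete spaces of `B12RegularSpaces111` (`B12Lemma4ConcreteFrame.Lemma4Data`:
  the frames of `X` (scale `j`) and of `□₀ = □̃⁵` (scale `k+1`), `Y = □̃³`, the projection `π` of (1.8), `η`, the set (3.31) `A331`, the size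
  `normB = |B′|`, the maps `𝐊 = 𝐇_j(□₀, τQ(L⁻¹η𝐇_{k+1}(□₀, (1/i) log V(𝐔))))` ((3.26)–(3.30), (3.37)) and `𝐀₂` ((3.47)–(3.50)), the model data, and
  for every value of the variables a `JInputs` package — the gauge transformations `u_j, ū_{k+1}, v_j, v` with the costs (3.26)/(3.27)/(3.37),
  the identities (3.37)+(3.39), (3.38), (3.42), the sizes (3.37), (3.45), (3.50) — and the analyticity of the letters of `𝐊`, `𝐀₂`);
* `v`, `uk1` — the gauge transformations `v(𝐔)` of (3.26) and `u_{k+1}(𝐔)` of (3.27) as functions of `𝐔` (p. 276: «explicitly given analytic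
  functions of 𝐔»);
* `U325`, `g328` — the gauge-field argument of (3.25) as a function of `(𝐔, 𝐀)` and the composite gauge transformation taking the Lemma-4
  configuration to it ((3.28); see `Eq328Printed`);
* `R329` — the recipe of the invariance statement (3.29) on abstract carriers (`B12Inv329.Recipe`: the group `𝒢` of gauge transformations
  acting on backgrounds `𝔘`, on the `𝐉`-variables `𝔍` and the `B`-variables `𝔅`, the block-centre restriction `bc`, the re-minimised
  background `𝒰` with its covariance `cov` («transform … by R(u(y₀))»), the jointly invariant functional `Ψ` of (3.25)); `gValued` — the
  `G`-valued transformations; `nbhd329` — «a sufficiently small neighborhood of G-valued transformations» (p. 276 L18).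
DATA only; nothing printed is asserted by inhabiting this structure except the existence of the package `D` (HONEST SCOPE (a)).
[cite: Balaban1987RG1, (3.26)-(3.31) pp.275-276, (3.37)-(3.50) pp.277-280, Lemma 4 p.280, (3.29) p.276] -/
structure Letters (P : Params) (i : ℕ) (𝔸 : Type) [NormedRing 𝔸] [NormedAlgebra ℂ 𝔸] [CompleteSpace 𝔸] (𝓜 : Model 𝔸)
    (c : B12Sec2to5.Lemma4Consts) (𝒢 𝔘 𝔍 𝔅 W : Type*) [Group 𝒢] [MulAction 𝒢 𝔘] [MulAction 𝒢 𝔍] [MulAction 𝒢 𝔅] where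
  /-- the by-reference package of Lemma 4 on the concrete frame ((3.26)–(3.31), (3.37)–(3.50), [12, 14, 15]) -/
  D : Lemma4Data P i 𝓜 c
  /-- the axial-gauge transformation `v(𝐔)` of (3.26) ([15] Sect. F) -/
  v : FieldPair P i 𝔸ˣ 𝔸 → Site P i → 𝔸ˣ
  /-- the Landau-gauge transformation `u_{k+1}(𝐔)` of (3.27) ([15] Prop. 9) -/
  uk1 : FieldPair P i 𝔸ˣ 𝔸 → Site P i → 𝔸ˣ
  /-- the gauge-field argument of (3.25) as a function of `𝐔` and of the `𝔤ᶜ`-valued variable `𝐀` of (3.30) -/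
  U325 : FieldPair P i 𝔸ˣ 𝔸 → (PBond P i → 𝔸) → PBond P i → 𝔸ˣ
  /-- the composite gauge transformation of (3.26)/(3.27)/(3.37) taking the Lemma-4 configuration to `U325` ((3.28)) -/
  g328 : FieldPair P i 𝔸ˣ 𝔸 → (PBond P i → 𝔸) → Site P i → 𝔸ˣ
  /-- the recipe of (3.25)/(3.28)–(3.29) on abstract carriers (`B12Inv329` §1) -/
  R329 : B12Inv329.Recipe 𝒢 𝔘 𝔍 𝔅 W
  /-- the `G`-valued gauge transformations inside `𝒢` -/
  gValued : Set 𝒢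
  /-- «a sufficiently small neighborhood of G-valued transformations» (p. 276 L18) -/
  nbhd329 : Set 𝒢

/-- **THE BUNDLE OF BLOCK 22: [I] Sect. 3, part 2, pp. 275–281, IN HYPOTHESIS FORM**, conjoining BY NAME over the letters `𝔩`:
* `restrictions` — «for α₀, α₁, α₂, α₃ sufficiently small and satisfying all the restrictions» (Lemma 4 p. 280; the restrictions of pp. 275–280:
  `B12Sec2to5.Lemma4Restrictions`);
* `normB_zero` — `|0| = 0` for the size letter `|B′|` of the frame (print's supremum norm; HONEST SCOPE (b));
* `gauge276` — p. 276 L12–14, the residual `Gauge276Printed` at the upper space U′ᶜ_{k+1}(□₀, (1+2β)α₀, (1+2β)α₁) of the frame and the cube `□₀`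
  (the region `D.F'.X` of the frame of `□₀`);
* `eq328` — p. 276 L2 / (3.28), the residual `Eq328Printed`;
* `gValued_sub` — the neighbourhood of (3.29) contains the `G`-valued transformations;
* `inv329` — (3.29) p. 276 L15–20: the function (3.25) is invariant under the simultaneous transformations `𝐔 → 𝐔^u, 𝐉 → R(u)𝐉, B → R(u)B` for
  every `u` of the neighbourhood (`B12Inv329.Recipe.Inv329At`, the typed row, BY NAME).
Lemma 4 (3.53) is NOT a field: it is a theorem for every package (`Letters.lemma4` below); (3.32)–(3.35), (3.40)–(3.52), (3.54) and the p. 280/281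
remarks are PROVED in the tree (INDEX) and are not fields either.  A `Prop`-valued record of named fields (fan precedent N-c2-17/21);
nothing is asserted by this declaration. [cite: Balaban1987RG1, (3.26)-(3.54) pp.275-280, Lemma 4 p.280, p.281 L2-7] -/
structure Hyp {P : Params} {i : ℕ} {𝔸 : Type} [NormedRing 𝔸] [NormedAlgebra ℂ 𝔸] [CompleteSpace 𝔸] {𝓜 : Model 𝔸}
    {c : B12Sec2to5.Lemma4Consts} {𝒢 𝔘 𝔍 𝔅 W : Type*} [Group 𝒢] [MulAction 𝒢 𝔘] [MulAction 𝒢 𝔍] [MulAction 𝒢 𝔅]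
    (𝔩 : Letters P i 𝔸 𝓜 c 𝒢 𝔘 𝔍 𝔅 W) : Prop where
  /-- «satisfying all the restrictions» (Lemma 4 p. 280; pp. 275–280) -/
  restrictions : B12Sec2to5.Lemma4Restrictions c
  /-- `|0| = 0` for the frame's size letter `|B′|` -/
  normB_zero : 𝔩.D.normB 0 = 0
  /-- p. 276 L12–14: `v(𝐔)`, `u_{k+1}(𝐔)` are analytic in `𝐔` and depend on `𝐔|□₀` only -/
  gauge276 : Gauge276Printed (space 𝓜 𝔩.D.F' 𝔩.D.cs' ((1 + 2 * c.β) * c.α₀) ((1 + 2 * c.β) * c.α₁) 𝔩.D.γ₀')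
    𝔩.D.F'.X 𝔩.v 𝔩.uk1
  /-- p. 276 L2, (3.28): the (3.25) configuration is the gauge transform of the Lemma-4 configuration -/
  eq328 : Eq328Printed 𝓜 c 𝔩.D 𝔩.U325 𝔩.g328
  /-- the neighbourhood of (3.29) contains the `G`-valued transformations -/
  gValued_sub : 𝔩.gValued ⊆ 𝔩.nbhd329
  /-- (3.29) on the neighbourhood -/
  inv329 : ∀ u ∈ 𝔩.nbhd329, 𝔩.R329.Inv329At u

/-! ## §3  Kernel-checked bookkeeping out of the letters and the bundle (no printed statement asserted) -/

section Bookkeeping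

variable {P : Params} {i : ℕ} {𝔸 : Type} [NormedRing 𝔸] [NormedAlgebra ℂ 𝔸] [CompleteSpace 𝔸] {𝓜 : Model 𝔸}
  {c : B12Sec2to5.Lemma4Consts} {𝒢 𝔘 𝔍 𝔅 W : Type*} [Group 𝒢] [MulAction 𝒢 𝔘] [MulAction 𝒢 𝔍] [MulAction 𝒢 𝔅]

/-- **Lemma 4 (3.53), the decl of record `B12Sec2to5.Lemma4Printed`, holds on the concrete frame of the letters** — for every package of the
by-reference inputs, by the tree's `B12Lemma4ConcreteFrame.lemma4Printed_frameOf` (membership by `B12Lemma4Assembled`, analyticity by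
`B12CondIIIJConcreteModels.analyticAt_pair_lemma4`).  This is why Lemma 4 is not a field of `Hyp`. [cite: Balaban1987RG1, Lemma 4 (3.53) p.280] -/
theorem Letters.lemma4 [NormOneClass 𝔸] (𝔩 : Letters P i 𝔸 𝓜 c 𝒢 𝔘 𝔍 𝔅 W) :
    B12Sec2to5.Lemma4Printed (frameOf 𝓜 c 𝔩.D) c :=
  lemma4Printed_frameOf 𝔩.D

/-- **(3.29) for BLOCK-CONSTANT transformations needs no hypothesis**: by the recipe algebra of `B12Inv329` (`inv329At_of_isBlockConstant`:
the covariance `cov` — «transform … by R(u(y₀))» — and the joint invariance of the slots), every `u` with `ũ = u` satisfies (3.29).  The field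
`Hyp.inv329` is consumed only beyond this class (the cell's located reading G-adv7-7, cited not adjudicated). [cite: Balaban1987RG1, (3.29) p.276 L15-22] -/
theorem Letters.inv329_blockConstant (𝔩 : Letters P i 𝔸 𝓜 c 𝒢 𝔘 𝔍 𝔅 W) {u : 𝒢} (hu : 𝔩.R329.IsBlockConstant u) :
    𝔩.R329.Inv329At u :=
  𝔩.R329.inv329At_of_isBlockConstant hu

variable {𝔩 : Letters P i 𝔸 𝓜 c 𝒢 𝔘 𝔍 𝔅 W}

/-- (3.29) for the `G`-valued transformations, out of the bundle. [cite: Balaban1987RG1, (3.29) p.276 L15-20] -/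
theorem Hyp.inv329_gValued (h : Hyp 𝔩) {u : 𝒢} (hu : u ∈ 𝔩.gValued) : 𝔩.R329.Inv329At u :=
  h.inv329 u (h.gValued_sub hu)

/-- **The membership (3.53)/(3.36), unbundled**: under the bundle's restrictions, for `𝐔` in the upper space, `𝐀` in (3.31), `τ ∈ [0, 1]` and
`|B′| < α₃`, the Lemma-4 pair `(V, J(V))`, `V = exp iξ(𝐊 + 𝐀₂)`, lies in `U^c_j(X, α₀, α₁)` (`B12Lemma4ConcreteFrame.comp_mem_Ucj`).
[cite: Balaban1987RG1, Lemma 4 (3.53) p.280; (3.36) p.277] -/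
theorem Hyp.comp_mem [NormOneClass 𝔸] (h : Hyp 𝔩) {Φ : FieldPair P i 𝔸ˣ 𝔸} {A : PBond P i → 𝔸} {τ : ℝ} {B' : PBond P i → 𝔸}
    (hΦ : Φ ∈ space 𝓜 𝔩.D.F' 𝔩.D.cs' ((1 + 2 * c.β) * c.α₀) ((1 + 2 * c.β) * c.α₁) 𝔩.D.γ₀') (hA : A ∈ 𝔩.D.A331)
    (hτ0 : 0 ≤ τ) (hτ1 : τ ≤ 1) (hB' : 𝔩.D.normB B' < c.α₃) :
    ofBackground 𝔩.D.π 𝔩.D.cs.ξ (fun b => expI 𝔩.D.cs.ξ (𝔩.D.K Φ A τ b + 𝔩.D.A₂ Φ A τ B' b)) ∈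
      space' 𝓜 𝔩.D.F 𝔩.D.cs c.α₀ c.α₁ :=
  comp_mem_Ucj 𝔩.D h.restrictions hΦ hA hτ0 hτ1 hB'

/-- **p. 275 [PDF 27], the block's opening claim, out of the bundle: *«We will prove that it [(3.25)] is analytic on the space U^c_{k+1}(□₀,
(1+2β)α₀, (1+2β)α₁, α₀)»*** — for `𝐄^{(j)}(X, ·)` analytic on `U^c_j(X, α₀, α₁)` and gauge invariant under `Gᶜ`-valued transformations ((1.18),
(1.19) p. 263, hypotheses `hE`, `hinv` in the shapes of `B12Lemma4Uses`), along every analytic family `e ↦ (𝐔(e), 𝐉(e)), 𝐀(e)` of the variables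
that stays, near `e₀`, in the upper space × the class (3.31), the function `e ↦ 𝐄^{(j)}(X, (U325, J(U325))(𝐔(e), 𝐀(e)))` — (3.25) after the
renaming of p. 276, its `𝐉`-slot the current of its `𝐔`-slot ((1.9), p. 275) — is analytic at `e₀`: `Hyp.eq328` feeds the binders `h328`/`hg`
of `B12Lemma4Uses.analyticAt_E325_of_eq328U` at `τ = 1`, `B′ = 0` (`Hyp.normB_zero`, `Hyp.restrictions` for `0 < α₃`), which composes
Lemma 4 on the frame with (1.18)/(1.19). [cite: Balaban1987RG1, p.275 L19-21; (3.28)-(3.29) p.276; Lemma 4 p.280; (1.18)-(1.19) p.263] -/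
theorem Hyp.analyticAt_E325 [NormOneClass 𝔸] (h : Hyp 𝔩) {V : Type*} [NormedAddCommGroup V] [NormedSpace ℂ V]
    (E : (PBond P i → 𝔸) × (PBond P i → 𝔸) → V)
    (hE : ∀ Ψ ∈ space' 𝓜 𝔩.D.F 𝔩.D.cs c.α₀ c.α₁, AnalyticAt ℂ E ((fun b => (Ψ.U b : 𝔸)), Ψ.J))
    (hinv : ∀ Ψ ∈ space' 𝓜 𝔩.D.F 𝔩.D.cs c.α₀ c.α₁, ∀ u : Site P i → 𝔸ˣ, (∀ x, u x ∈ 𝓜.Gc) →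
      E ((fun b => ((act u Ψ).U b : 𝔸)), (act u Ψ).J) = E ((fun b => (Ψ.U b : 𝔸)), Ψ.J))
    {X : Type} [NormedAddCommGroup X] [NormedSpace ℂ X] {Φf : X → FieldPair P i 𝔸ˣ 𝔸} {Af : X → PBond P i → 𝔸} {e₀ : X}
    (hU : ∀ b, AnalyticAt ℂ (fun e => ((Φf e).U b : 𝔸)) e₀) (hJ : ∀ b, AnalyticAt ℂ (fun e => (Φf e).J b) e₀)
    (hAf : ∀ b, AnalyticAt ℂ (fun e => Af e b) e₀)
    (hdom : ∀ᶠ e in 𝓝 e₀, Φf e ∈ space 𝓜 𝔩.D.F' 𝔩.D.cs' ((1 + 2 * c.β) * c.α₀) ((1 + 2 * c.β) * c.α₁) 𝔩.D.γ₀' ∧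
      Af e ∈ 𝔩.D.A331) :
    AnalyticAt ℂ (fun e : X => E ((fun b => ((ofBackground 𝔩.D.π 𝔩.D.cs.ξ (𝔩.U325 (Φf e) (Af e))).U b : 𝔸)),
      (ofBackground 𝔩.D.π 𝔩.D.cs.ξ (𝔩.U325 (Φf e) (Af e))).J)) e₀ := by
  have hα₃ : 0 < c.α₃ := h.restrictions.2.2.2.1
  have hLe : LettersAnalyticAt Φf Af (fun _ : X => (0 : PBond P i → 𝔸)) e₀ :=
    ⟨hU, hJ, hAf, fun _ => analyticAt_const⟩
  have hdomf : ∀ᶠ e in 𝓝 e₀, Φf e ∈ space 𝓜 𝔩.D.F' 𝔩.D.cs' ((1 + 2 * c.β) * c.α₀) ((1 + 2 * c.β) * c.α₁) 𝔩.D.γ₀' ∧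
      Af e ∈ 𝔩.D.A331 ∧ 𝔩.D.normB ((fun _ : X => (0 : PBond P i → 𝔸)) e) < c.α₃ := by
    filter_upwards [hdom] with e he
    exact ⟨he.1, he.2, by simpa [h.normB_zero] using hα₃⟩
  have hg : ∀ᶠ e in 𝓝 e₀, ∀ x, 𝔩.g328 (Φf e) (Af e) x ∈ 𝓜.Gc := by
    filter_upwards [hdom] with e he
    exact (h.eq328 _ he.1 _ he.2).1
  have h328 : ∀ᶠ e in 𝓝 e₀, 𝔩.U325 (Φf e) (Af e) = gaugeU (𝔩.g328 (Φf e) (Af e))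
      (fun b => expI 𝔩.D.cs.ξ (𝔩.D.K (Φf e) (Af e) 1 b + 𝔩.D.A₂ (Φf e) (Af e) 1 ((fun _ : X => (0 : PBond P i → 𝔸)) e) b)) := by
    filter_upwards [hdom] with e he
    exact (h.eq328 _ he.1 _ he.2).2
  exact B12Lemma4Uses.analyticAt_E325_of_eq328U 𝔩.D h.restrictions E hE hinv hLe zero_le_one le_rfl hdomf hg h328

/-- The analyticity half of p. 276 L12–14, out of the bundle: along an analytic family of configurations through a point of the upper space,
every site value of `v(𝐔(e))` and of `u_{k+1}(𝐔(e))` is analytic. [cite: Balaban1987RG1, p.276 L12-13] -/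
theorem Hyp.gauge_analytic (h : Hyp 𝔩) {X : Type} [NormedAddCommGroup X] [NormedSpace ℂ X] {Φf : X → FieldPair P i 𝔸ˣ 𝔸} {e₀ : X}
    (hU : ∀ b, AnalyticAt ℂ (fun e => ((Φf e).U b : 𝔸)) e₀)
    (hΦ : Φf e₀ ∈ space 𝓜 𝔩.D.F' 𝔩.D.cs' ((1 + 2 * c.β) * c.α₀) ((1 + 2 * c.β) * c.α₁) 𝔩.D.γ₀') (x : Site P i) :
    AnalyticAt ℂ (fun e => (𝔩.v (Φf e) x : 𝔸)) e₀ ∧ AnalyticAt ℂ (fun e => (𝔩.uk1 (Φf e) x : 𝔸)) e₀ :=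
  h.gauge276.1 X Φf e₀ hU hΦ x

/-- The locality half of p. 276 L12–14, out of the bundle («depending on 𝐔 restricted to the cube □₀»): two configurations of the upper space whose
gauge fields agree on the bonds of `□₀` have the same `v` and the same `u_{k+1}`. [cite: Balaban1987RG1, p.276 L12-14] -/
theorem Hyp.gauge_local (h : Hyp 𝔩) {Φ Φ' : FieldPair P i 𝔸ˣ 𝔸}
    (hΦ : Φ ∈ space 𝓜 𝔩.D.F' 𝔩.D.cs' ((1 + 2 * c.β) * c.α₀) ((1 + 2 * c.β) * c.α₁) 𝔩.D.γ₀')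
    (hΦ' : Φ' ∈ space 𝓜 𝔩.D.F' 𝔩.D.cs' ((1 + 2 * c.β) * c.α₀) ((1 + 2 * c.β) * c.α₁) 𝔩.D.γ₀')
    (hagree : ∀ b ∈ 𝔩.D.F'.X.bonds, Φ.U b = Φ'.U b) : 𝔩.v Φ = 𝔩.v Φ' ∧ 𝔩.uk1 Φ = 𝔩.uk1 Φ' :=
  h.gauge276.2 Φ hΦ Φ' hΦ' hagree

end Bookkeeping

end Literature.MathematicalPhysics.QuantumFieldTheory.Balaban1983to89.B12Carve22Sect3Lemma4Hyp
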